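import Summits.Parity.GeneralizedHardyLittlewood.Theses.LeeYangFibres
import Summits.Parity.GeneralizedHardyLittlewood.Theorems.LeeYangFibresPrimeCellsRelativeLocator
import Summits.Parity.GeneralizedHardyLittlewood.Theorems.RelativeDimOne.Negative.RelativeDimOneRepeatedForm
import HarnessLib

/-!
# Crux `PrimeCellsRelative` (stmt-Parity-14112), line `Sketch`: the `∃ u / ∀ u` choice is not load-bearing

The crux `PrimeCellsRelative` asks, for every `t ≥ 1`, `L`, `ε > 0`, for SOME roughness exponent `u ≥ 2` (and a
threshold `N₀`) at which the rough prime cells `#{n ∈ K ∩ [-N, N] : every ψᵢ(n) a prime > N^{1/u}}` obey the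
counting Dickson–Hardy–Littlewood asymptotic with Green–Tao's relative + absolute error. The standing disprover
(`Cruxes/PrimeCellsRelative/Disproof.lean`, (c) natural strengthenings) lists the variant with `∀ u ≥ 2` in place of
`∃ u ≥ 2` as open. This file settles the COMPARISON: the two variants are EQUIVALENT
(`primeCellsRelative_iff_forall_u`), so the quantifier on `u` carries no content of its own.

Proof: `PrimeCellsRelative → RelativeDimOne` (item stmt-Parity-14115, `cellsToRelativeDimOne_proof`, PROVED) and the
up-transfer `RelativeDimOne ⟹ cells` run at an ARBITRARY exponent `u ≥ 2` (`upTransfer_at`, the landed one-scale step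
`abs_cells_sub_le_of_vonMangoldtSum` of `…PrimeCellsRelativeUpTransfer` already allows any `u ≥ 2`: the primes
`≤ N^{1/u} ≤ √N` and the difference `π(N) - A₁(N) ≤ √N` are absorbed by the absolute term `ε N / log^t N`).

References: B. Green, T. Tao, *Linear equations in primes*, Ann. of Math. 171 (2010), Conj. 1.4 and the sketch proof
after (1.8) [GreenTao2010].
-/

noncomputable section

namespace Summit.Parity.GeneralizedHardyLittlewood.Cruxes.PrimeCellsRelative.Sketch

open scoped BigOperators Topology Classical
open Filter Finset Literature.NumberTheory.Sieve
open Summit.Parity.GeneralizedHardyLittlewood.Theses.LeeYangFibres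
open Summit.Parity.GeneralizedHardyLittlewood.Theorems.LeeYangFibresCells

/-- **Up-transfer at a prescribed roughness exponent.** `RelativeDimOne` at `t` forms gives the rough prime cells
with Green–Tao's relative + absolute error at EVERY `u ≥ 2` (not just at some `u`): the proof of the registered stub
`stub_upTransfer` with `2` replaced by `u`, through the landed one-scale step `abs_cells_sub_le_of_vonMangoldtSum`.
[cite: GreenTao2010, Conj. 1.4 (sketch proof)] -/
theorem upTransfer_at (t : ℕ) (ht : 1 ≤ t)
    (hR : ∀ L : ℕ, ∀ ε : ℝ, 0 < ε → ∃ N₀ : ℕ, ∀ N : ℕ, N₀ ≤ N → ∀ Ψ : Fin t → Literature.NumberTheory.Sieve.AffLinForm 1, Literature.NumberTheory.Sieve.IsNondegenerateSystem Ψ → Literature.NumberTheory.Sieve.affLinSize Ψ N ≤ L → ∀ K : Set (Fin 1 → ℝ), Convex ℝ K → K ⊆ Literature.NumberTheory.Sieve.realBox 1 N → |Literature.NumberTheory.Sieve.vonMangoldtSum Ψ K N - Literature.NumberTheory.Sieve.archFactor Ψ K * Literature.NumberTheory.Sieve.singularProduct Ψ| ≤ ε * (Literature.NumberTheory.Sieve.archFactor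 Ψ K * Literature.NumberTheory.Sieve.singularProduct Ψ + N))
    (L : ℕ) (ε : ℝ) (hε : 0 < ε) (u : ℕ) (hu : 2 ≤ u) :
    ∃ N₀ : ℕ, ∀ N : ℕ, N₀ ≤ N → ∀ Ψ : Fin t → Literature.NumberTheory.Sieve.AffLinForm 1, Literature.NumberTheory.Sieve.IsNondegenerateSystem Ψ → Literature.NumberTheory.Sieve.affLinSize Ψ N ≤ L → ∀ K : Set (Fin 1 → ℝ), Convex ℝ K → K ⊆ Literature.NumberTheory.Sieve.realBox 1 N → |((((Literature.NumberTheory.Sieve.latticeBox 1 N).filter (fun n => Literature.NumberTheory.Sieve.realPoint n ∈ K ∧ ∀ i, (N : ℝ) ^ ((1 : ℝ) / u) < (Nat.minFac ((Ψ i).eval n).toNat : ℝ) ∧ ArithmeticFunction.cardFactors ((Ψ i).eval n).toNat = 1)).card : ℕ) : ℝ) - Literature.NumberTheory.Sieve.archFactor Ψ K * Literature.NumberTheory.Sieve.singularProduct Ψ * (((((Finset.Icc 1 N).filter (fun m => (N : ℝ) ^ ((1 : ℝ) / u) < (Nat.minFac m : ℝ) ∧ ArithmeticFunction.cardFactors m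 = 1)).card : ℕ) : ℝ) / N) ^ t| ≤ ε * (Literature.NumberTheory.Sieve.archFactor Ψ K * Literature.NumberTheory.Sieve.singularProduct Ψ * (((((Finset.Icc 1 N).filter (fun m => (N : ℝ) ^ ((1 : ℝ) / u) < (Nat.minFac m : ℝ) ∧ ArithmeticFunction.cardFactors m = 1)).card : ℕ) : ℝ) / N) ^ t + N / Real.log N ^ t) := by
  -- precision bookkeeping: `ε₀ = min ε 1`, `η = η(ε₀/16)`, the relative input at precision `ε₀/16`
  set ε₀ : ℝ := min ε 1 with hε₀def
  have hε₀ : 0 < ε₀ := lt_min hε one_pos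
  have hε₀1 : ε₀ ≤ 1 := min_le_right _ _
  have hε₀ε : ε₀ ≤ ε := min_le_left _ _
  have ha0 : 0 < ε₀ / 16 := by positivity
  obtain ⟨η, hη0, hη2, hηp, hηm⟩ := exists_eta_pow_near_one t ha0
  obtain ⟨N₁, hN₁⟩ := hR L (ε₀ / 16) ha0
  obtain ⟨N₂, hN₂⟩ := Filter.eventually_atTop.mp (eventually_primeCounting_window hη0)
  -- growth conditions on the scale
  have hden : (0 : ℝ) < 12 * t * (Real.sqrt (2 * L) + 1) := by
    have ht0 : (0 : ℝ) < t := by exact_mod_cast ht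
    positivity
  set c₂ : ℝ := ε₀ / 16 / (12 * t * (Real.sqrt (2 * L) + 1)) with hc₂def
  have hc₂0 : 0 < c₂ := div_pos ha0 hden
  have hc₂ : 12 * t * (Real.sqrt (2 * L) + 1) * c₂ ≤ ε₀ / 16 := by
    rw [hc₂def, mul_div_cancel₀ _ hden.ne']
  obtain ⟨N₃, hN₃⟩ := Filter.eventually_atTop.mp (eventually_log_growth t
    (max (Real.log (2 * L) / η) (144 * t / ε₀)) hη0 one_pos hc₂0)
  refine ⟨max N₁ (max N₂ (max N₃ 3)), fun N hN Ψ hΨ hL K hK hKN => ?_⟩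
  have hNN₁ : N₁ ≤ N := le_trans (le_max_left _ _) hN
  have hNN₂ : N₂ ≤ N := le_trans ((le_max_left _ _).trans (le_max_right _ _)) hN
  have hNN₃ : N₃ ≤ N :=
    le_trans ((le_max_left _ _).trans ((le_max_right _ _).trans (le_max_right _ _))) hN
  have hN3 : 3 ≤ N :=
    le_trans ((le_max_right _ _).trans ((le_max_right _ _).trans (le_max_right _ _))) hN
  obtain ⟨hCℓ, hloglog, hℓpow, hℓsqrt⟩ := hN₃ N hNN₃
  have hℓL : Real.log (2 * L) ≤ η * Real.log N := by
    have h1 : Real.log (2 * L) / η ≤ Real.log N := (le_max_left _ _).trans hCℓ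
    rw [div_le_iff₀ hη0] at h1
    linarith
  have hℓt : 144 * t ≤ ε₀ * Real.log N := by
    have h1 : 144 * t / ε₀ ≤ Real.log N := (le_max_right _ _).trans hCℓ
    rw [div_le_iff₀ hε₀] at h1
    linarith
  have hZ0 : 0 ≤ (N : ℝ) ^ ((1 : ℝ) / u) := by positivity
  exact abs_cells_sub_le_of_vonMangoldtSum Ψ K ht hN3 hu hε₀ hε₀1 hε₀ε hη2 hηp hηm hΨ hL hc₂0
    hc₂ hℓL hℓt hloglog hℓpow hℓsqrt (hN₂ N hNN₂) (hN₁ N hNN₁ Ψ hΨ hL K hK hKN) (Nat.cast_nonneg _)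
    (card_cells_le_primePointCount N _ Ψ K) (primePointCount_le_card_cells_add hZ0 Ψ hΨ K)
    (primeCounting_le_card_roughPrimes_add N hZ0) (card_roughPrimes_le_primeCounting N _)

/-- **`RelativeDimOne` gives the rough prime cells at every exponent `u ≥ 2`** (the `∀ u` form of the crux), by
`upTransfer_at` at each `t ≥ 1`. [cite: GreenTao2010, Conj. 1.4 (sketch proof)] -/
theorem primeCellsRelative_forall_u_of_relativeDimOne (hR : RelativeDimOne) :
    ∀ (t L : ℕ), 1 ≤ t → ∀ ε : ℝ, 0 < ε → ∀ u : ℕ, 2 ≤ u → ∃ N₀ : ℕ, ∀ N : ℕ, N₀ ≤ N → ∀ Ψ : Fin t → Literature.NumberTheory.Sieve.AffLinForm 1, Literature.NumberTheory.Sieve.IsNondegenerateSystem Ψ → Literature.NumberTheory.Sieve.affLinSize Ψ N ≤ L → ∀ K : Set (Fin 1 → ℝ), Convex ℝ K → K ⊆ Literature.NumberTheory.Sieve.realBox 1 N → |((((Literature.NumberTheory.Sieve.latticeBox 1 N).filter (fun n => Literature.NumberTheory.Sieve.realPoint n ∈ K ∧ ∀ i, (N : ℝ) ^ ((1 : ℝ)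 / u) < (Nat.minFac ((Ψ i).eval n).toNat : ℝ) ∧ ArithmeticFunction.cardFactors ((Ψ i).eval n).toNat = 1)).card : ℕ) : ℝ) - Literature.NumberTheory.Sieve.archFactor Ψ K * Literature.NumberTheory.Sieve.singularProduct Ψ * (((((Finset.Icc 1 N).filter (fun m => (N : ℝ) ^ ((1 : ℝ) / u) < (Nat.minFac m : ℝ) ∧ ArithmeticFunction.cardFactors m = 1)).card : ℕ) : ℝ) / N) ^ t| ≤ ε * (Literature.NumberTheory.Sieve.archFactor Ψ K * Literature.NumberTheory.Sieve.singularProduct Ψ * (((((Finset.Icc 1 N).filter (fun m => (N : ℝ) ^ ((1 : ℝ) / u) < (Nat.minFac m : ℝ) ∧ ArithmeticFunction.cardFactors m = 1)).card : ℕ) : ℝ) / N) ^ t + N / Real.log N ^ t) :=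
  fun t L ht ε hε u hu => upTransfer_at t ht (fun L' ε' hε' => hR t L' ht ε' hε') L ε hε u hu

/-- **The `∃ u / ∀ u` choice in the crux is not load-bearing: `PrimeCellsRelative` is EQUIVALENT to its `∀ u ≥ 2`
form.** Forward: `PrimeCellsRelative → RelativeDimOne` (item stmt-Parity-14115, `cellsToRelativeDimOne_proof`,
PROVED), then `primeCellsRelative_forall_u_of_relativeDimOne`; backward: specialise to `u = 2`. This answers the
standing disprover's open strengthening (c) of `Cruxes/PrimeCellsRelative/Disproof.lean`: conjecturally every
`u ≥ 2` works, and PROVABLY the `∀ u` variant is no stronger than the crux. [cite: GreenTao2010, Conj. 1.4 (sketch proof)] -/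
theorem primeCellsRelative_iff_forall_u :
    PrimeCellsRelative ↔
    (∀ (t L : ℕ), 1 ≤ t → ∀ ε : ℝ, 0 < ε → ∀ u : ℕ, 2 ≤ u → ∃ N₀ : ℕ, ∀ N : ℕ, N₀ ≤ N → ∀ Ψ : Fin t → Literature.NumberTheory.Sieve.AffLinForm 1, Literature.NumberTheory.Sieve.IsNondegenerateSystem Ψ → Literature.NumberTheory.Sieve.affLinSize Ψ N ≤ L → ∀ K : Set (Fin 1 → ℝ), Convex ℝ K → K ⊆ Literature.NumberTheory.Sieve.realBox 1 N → |((((Literature.NumberTheory.Sieve.latticeBox 1 N).filter (fun n => Literature.NumberTheory.Sieve.realPoint n ∈ K ∧ ∀ i, (N : ℝ) ^ ((1 : ℝ) / u) < (Nat.minFac ((Ψ i).eval n).toNat : ℝ) ∧ ArithmeticFunction.cardFactors ((Ψ i).eval n).toNat = 1)).card : ℕ) : ℝ) - Literature.NumberTheory.Sieve.archFactor Ψ K * Literature.NumberTheory.Sieve.singularProduct Ψ * (((((Finset.Icc 1 N).filter (fun m => (N : ℝ) ^ ((1 : ℝ) / u) < (Nat.minFac m : ℝ) ∧ ArithmeticFunction.cardFactors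 m = 1)).card : ℕ) : ℝ) / N) ^ t| ≤ ε * (Literature.NumberTheory.Sieve.archFactor Ψ K * Literature.NumberTheory.Sieve.singularProduct Ψ * (((((Finset.Icc 1 N).filter (fun m => (N : ℝ) ^ ((1 : ℝ) / u) < (Nat.minFac m : ℝ) ∧ ArithmeticFunction.cardFactors m = 1)).card : ℕ) : ℝ) / N) ^ t + N / Real.log N ^ t)) := by
  refine ⟨fun hP => primeCellsRelative_forall_u_of_relativeDimOne
    (Theorems.LeeYangFibresCells.cellsToRelativeDimOne_proof hP), fun hA t L ht ε hε => ?_⟩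
  exact ⟨2, le_rfl, hA t L ht ε hε 2 le_rfl⟩

/-- **Corollary: the crux at the fixed exponent `u = 2` (primes `> √N`) is already equivalent to the crux.**
[cite: GreenTao2010, Conj. 1.4 (sketch proof)] -/
theorem primeCellsRelative_iff_at_two :
    PrimeCellsRelative ↔
    (∀ (t L : ℕ), 1 ≤ t → ∀ ε : ℝ, 0 < ε → ∃ N₀ : ℕ, ∀ N : ℕ, N₀ ≤ N → ∀ Ψ : Fin t → Literature.NumberTheory.Sieve.AffLinForm 1, Literature.NumberTheory.Sieve.IsNondegenerateSystem Ψ → Literature.NumberTheory.Sieve.affLinSize Ψ N ≤ L → ∀ K : Set (Fin 1 → ℝ), Convex ℝ K → K ⊆ Literature.NumberTheory.Sieve.realBox 1 N → |((((Literature.NumberTheory.Sieve.latticeBox 1 N).filter (fun n => Literature.NumberTheory.Sieve.realPoint n ∈ K ∧ ∀ i, (N : ℝ) ^ ((1 : ℝ) / (2 : ℕ)) < (Nat.minFac ((Ψ i).eval n).toNat : ℝ) ∧ ArithmeticFunction.cardFactors ((Ψ i).eval n).toNat = 1)).card : ℕ) : ℝ) - Literature.NumberTheory.Sieve.archFactor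 Ψ K * Literature.NumberTheory.Sieve.singularProduct Ψ * (((((Finset.Icc 1 N).filter (fun m => (N : ℝ) ^ ((1 : ℝ) / (2 : ℕ)) < (Nat.minFac m : ℝ) ∧ ArithmeticFunction.cardFactors m = 1)).card : ℕ) : ℝ) / N) ^ t| ≤ ε * (Literature.NumberTheory.Sieve.archFactor Ψ K * Literature.NumberTheory.Sieve.singularProduct Ψ * (((((Finset.Icc 1 N).filter (fun m => (N : ℝ) ^ ((1 : ℝ) / (2 : ℕ)) < (Nat.minFac m : ℝ) ∧ ArithmeticFunction.cardFactors m = 1)).card : ℕ) : ℝ) / N) ^ t + N / Real.log N ^ t)) := by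
  refine ⟨fun hP t L ht ε hε => (primeCellsRelative_iff_forall_u.mp hP) t L ht ε hε 2 le_rfl,
    fun h2 t L ht ε hε => ⟨2, le_rfl, h2 t L ht ε hε⟩⟩

/-! ## Uniformity of the threshold in the number of forms `t` -/

/-- **Uniformity of `u` and `N₀` in `t` costs nothing on the counting side either.** The crux is EQUIVALENT to
the form in which ONE exponent (`u = 2`) and ONE threshold `N₀(L, ε)` serve every number of forms `t ≥ 1` at once:
by `primeCellsRelative_iff_at_two` the exponent `2` works for each `t`, and since `‖Ψ‖_N ≥ t`
(`RelativeDimOne.Negative.card_le_affLinSize`, the Λ-side disprover's lemma) only `t ≤ L` is inhabited, so `N₀ := max_{t ≤ L} N₀(t)` serves all. This closes the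
planner-facing remark (g)(ii) of `Cruxes/PrimeCellsRelative/Disproof.lean` (there the `t`-uniformity was left open
because the `∃ u` of the crux may depend on `t`). [cite: GreenTao2010, Conj. 1.4 (sketch proof)] -/
theorem primeCellsRelative_iff_uniformInT :
    PrimeCellsRelative ↔
    (∀ L : ℕ, ∀ ε : ℝ, 0 < ε → ∃ N₀ : ℕ, ∀ t : ℕ, 1 ≤ t → ∀ N : ℕ, N₀ ≤ N → ∀ Ψ : Fin t → Literature.NumberTheory.Sieve.AffLinForm 1, Literature.NumberTheory.Sieve.IsNondegenerateSystem Ψ → Literature.NumberTheory.Sieve.affLinSize Ψ N ≤ L → ∀ K : Set (Fin 1 → ℝ), Convex ℝ K → K ⊆ Literature.NumberTheory.Sieve.realBox 1 N → |((((Literature.NumberTheory.Sieve.latticeBox 1 N).filter (fun n => Literature.NumberTheory.Sieve.realPoint n ∈ K ∧ ∀ i, (N : ℝ) ^ ((1 : ℝ) / (2 : ℕ)) < (Nat.minFac ((Ψ i).eval n).toNat : ℝ) ∧ ArithmeticFunction.cardFactors ((Ψ i).eval n).toNat = 1)).card : ℕ) : ℝ) - Literature.NumberTheory.Sieve.archFactor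 Ψ K * Literature.NumberTheory.Sieve.singularProduct Ψ * (((((Finset.Icc 1 N).filter (fun m => (N : ℝ) ^ ((1 : ℝ) / (2 : ℕ)) < (Nat.minFac m : ℝ) ∧ ArithmeticFunction.cardFactors m = 1)).card : ℕ) : ℝ) / N) ^ t| ≤ ε * (Literature.NumberTheory.Sieve.archFactor Ψ K * Literature.NumberTheory.Sieve.singularProduct Ψ * (((((Finset.Icc 1 N).filter (fun m => (N : ℝ) ^ ((1 : ℝ) / (2 : ℕ)) < (Nat.minFac m : ℝ) ∧ ArithmeticFunction.cardFactors m = 1)).card : ℕ) : ℝ) / N) ^ t + N / Real.log N ^ t)) := by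
  rw [primeCellsRelative_iff_at_two]
  constructor
  · intro h L ε hε
    choose N₀ hN₀ using fun t : ℕ => h (t + 1) L (Nat.le_add_left 1 t) ε hε
    refine ⟨(Finset.range L).sup N₀, fun t ht N hN Ψ hΨ hL K hK hKN => ?_⟩
    obtain ⟨t, rfl⟩ : ∃ t', t = t' + 1 := ⟨t - 1, by omega⟩
    by_cases htL : t < L
    · exact hN₀ t N ((Finset.le_sup (Finset.mem_range.mpr htL)).trans hN) Ψ hΨ hL K hK hKN
    · exfalso
      have h1 := Theorems.RelativeDimOne.Negative.card_le_affLinSize hΨ N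
      have h2 : (L : ℝ) < (t + 1 : ℕ) := by exact_mod_cast (show L < t + 1 by omega)
      linarith
  · intro h t L ht ε hε
    obtain ⟨N₀, hN₀⟩ := h L ε hε
    exact ⟨N₀, hN₀ t ht⟩

end Summit.Parity.GeneralizedHardyLittlewood.Cruxes.PrimeCellsRelative.Sketch

end
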